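import Summits.RiemannHypothesis.RiemannHypothesis.Theorems.OddSectorOddBartaFloorDefs
import Literature.NumberTheory.LFunctions.DeBruijnPhiDecreasing
import Literature.NumberTheory.LFunctions.WeilWindowSuzukiProofs
import HarnessLib

/-!
# Positivity of the polar weight and of the archimedean layer
(crux OddBartaFloor, line Sketch, stub imagePositivity)

For `a > 0`, the polar weight `ϖ_a = ∫_{s > a} (−Φ′(s))·2 sinh(s/2) ds` of the odd tail
`R_a = −Φ′ − H_a = 𝟙_{|s|>a}·(−Φ′)` is `≥ 0` (the integrand is `≥ 0` on `(a, ∞) ⊆ (0, ∞)` since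
`Φ′ < 0` there, `weilThetaPhiDeriv_neg_of_pos`), and the archimedean layer
`A_a(t) = ∫ R_a(s) w(|t − s|) ds` (`w = weilArchDensity`) is `≥ 0` for `t ∈ (0, a)`.

The second claim is proved WITHOUT any integrability: writing `f(s) = R_a(s) w(|t − s|)`, either `f`
is not integrable (and the Bochner integral is the junk value `0`), or `∫ f = ∫ f(−·)`
(`integral_neg_eq_self`), so `2∫ f = ∫ (f(s) + f(−s)) ds` and the symmetrised integrand
`f(s) + f(−s) = R_a(s)·(w(|t − s|) − w(|t + s|))` (`R_a` odd) is pointwise `≥ 0`: it vanishes on the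
window `|s| ≤ a`; for `s > a > t > 0` one has `R_a(s) = −Φ′(s) > 0` and `0 < s − t ≤ s + t`, whence
`w(s − t) ≥ w(s + t)` (`w` antitone on `(0, ∞)`, `weilArchDensity_antitoneOn`); for `s < −a` both
factors change sign. Sources: 2001 programme, route `odd-sector-eigenfunction-sign`, results §3
(internal, unpublished); Bombieri (2000), Thm 2 for the kernel `w`.
-/

set_option linter.dupNamespace false

noncomputable section

open Set MeasureTheory Filter Complex
open scoped Real Topology ComplexConjugate ArithmeticFunction.vonMangoldt ENNReal

namespace Summit.RiemannHypothesis.RiemannHypothesis.Theorems.OddBartaFloor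

open Literature.NumberTheory.LFunctions

/-- `ϖ_a ≥ 0` for `a > 0`: the polar weight of the odd tail is non-negative. -/
private theorem stub_imagePositivity_polarWeight_nonneg {a : ℝ} (ha : 0 < a) :
    0 ≤ oddThetaPolarWeight a := by
  unfold oddThetaPolarWeight
  refine setIntegral_nonneg measurableSet_Ioi fun s hs => ?_
  have hs0 : 0 < s := ha.trans hs
  exact mul_nonneg (neg_nonneg.2 (weilThetaPhiDeriv_neg_of_pos hs0).le)
    (mul_nonneg zero_le_two (Real.sinh_nonneg_iff.2 (by positivity)))

/-- The odd tail vanishes on the window `[−a, a]`. -/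
private theorem stub_imagePositivity_tail_of_mem {a s : ℝ} (h : s ∈ Icc (-a) a) :
    oddThetaTail a s = 0 := by
  rw [oddThetaTail_def, weilOddThetaVector_of_mem h, sub_self]

/-- Off the window the odd tail is `−Φ′`. -/
private theorem stub_imagePositivity_tail_of_not_mem {a s : ℝ} (h : s ∉ Icc (-a) a) :
    oddThetaTail a s = -weilThetaPhiDeriv s := by
  rw [oddThetaTail_def, weilOddThetaVector_of_not_mem h, sub_zero]

/-- The odd tail is odd: `R_a(−s) = −R_a(s)`. -/
private theorem stub_imagePositivity_tail_neg (a s : ℝ) :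
    oddThetaTail a (-s) = -oddThetaTail a s := by
  rw [oddThetaTail_def, oddThetaTail_def, weilThetaPhiDeriv_neg, weilOddThetaVector_neg]
  ring

/-- `R_a ≥ 0` on `[0, ∞)`. -/
private theorem stub_imagePositivity_tail_nonneg {a s : ℝ} (hs : 0 ≤ s) : 0 ≤ oddThetaTail a s := by
  by_cases h : s ∈ Icc (-a) a
  · rw [stub_imagePositivity_tail_of_mem h]
  · rw [stub_imagePositivity_tail_of_not_mem h, neg_nonneg]
    exact weilThetaPhiDeriv_nonpos hs

/-- `R_a ≤ 0` on `(−∞, 0]`. -/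
private theorem stub_imagePositivity_tail_nonpos {a s : ℝ} (hs : s ≤ 0) : oddThetaTail a s ≤ 0 := by
  have h := stub_imagePositivity_tail_nonneg (a := a) (neg_nonneg.2 hs)
  rw [stub_imagePositivity_tail_neg] at h
  linarith

/-- The symmetrised archimedean integrand is pointwise non-negative: for `t ∈ (0, a)` and every `s`,
`R_a(s) w(|t − s|) + R_a(−s) w(|t + s|) ≥ 0`. -/
private theorem stub_imagePositivity_symm_nonneg {a t : ℝ} (ht : t ∈ Ioo 0 a) (s : ℝ) :
    0 ≤ oddThetaTail a s * weilArchDensity |t - s| +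
      oddThetaTail a (-s) * weilArchDensity |t - -s| := by
  rw [stub_imagePositivity_tail_neg, sub_neg_eq_add]
  have key : 0 ≤ oddThetaTail a s * (weilArchDensity |t - s| - weilArchDensity |t + s|) := by
    by_cases hs : s ∈ Icc (-a) a
    · rw [stub_imagePositivity_tail_of_mem hs, zero_mul]
    · simp only [mem_Icc, not_and_or, not_le] at hs
      rcases hs with hs | hs
      · -- `s < -a`: `R_a(s) ≤ 0` and `|t - s| = t - s ≥ -(t + s) = |t + s| > 0`
        have h1 : |t - s| = t - s := abs_of_pos (by linarith [ht.1, ht.2])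
        have h2 : |t + s| = -(t + s) := abs_of_neg (by linarith [ht.2])
        have hpos : 0 < -(t + s) := by linarith [ht.2]
        have hle : -(t + s) ≤ t - s := by linarith [ht.1]
        have hw : weilArchDensity (t - s) ≤ weilArchDensity (-(t + s)) :=
          weilArchDensity_antitoneOn hpos (hpos.trans_le hle) hle
        rw [h1, h2]
        exact mul_nonneg_of_nonpos_of_nonpos
          (stub_imagePositivity_tail_nonpos (by linarith [ht.1, ht.2])) (sub_nonpos.2 hw)
      · -- `a < s`: `R_a(s) ≥ 0` and `0 < |t - s| = s - t ≤ t + s = |t + s|`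
        have h1 : |t - s| = s - t := by
          rw [abs_sub_comm]
          exact abs_of_pos (by linarith [ht.2])
        have h2 : |t + s| = t + s := abs_of_pos (by linarith [ht.1, ht.2])
        have hpos : 0 < s - t := by linarith [ht.2]
        have hle : s - t ≤ t + s := by linarith [ht.1]
        have hw : weilArchDensity (t + s) ≤ weilArchDensity (s - t) :=
          weilArchDensity_antitoneOn hpos (hpos.trans_le hle) hle
        rw [h1, h2]
        exact mul_nonneg (stub_imagePositivity_tail_nonneg (by linarith [ht.1, ht.2]))
          (sub_nonneg.2 hw)
  nlinarith [key]

/-- `A_a(t) ≥ 0` on the window: for `t ∈ (0, a)` the archimedean layer `∫ R_a(s) w(|t − s|) ds` is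
non-negative (symmetrisation `s ↦ −s`; no integrability needed, the non-integrable case being the
junk value `0`). -/
private theorem stub_imagePositivity_archLayer_nonneg {a t : ℝ} (ht : t ∈ Ioo 0 a) :
    0 ≤ oddThetaArchLayer a t := by
  unfold oddThetaArchLayer
  set f : ℝ → ℝ := fun s => oddThetaTail a s * weilArchDensity |t - s|
  by_cases hfi : Integrable f
  · have h1 : ∫ s, f (-s) = ∫ s, f s := integral_neg_eq_self f volume
    have h2 : ∫ s, f s + f (-s) = (∫ s, f s) + ∫ s, f (-s) := integral_add hfi hfi.comp_neg
    have h3 : 0 ≤ ∫ s, f s + f (-s) :=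
      integral_nonneg fun s => stub_imagePositivity_symm_nonneg ht s
    linarith
  · rw [integral_undef hfi]

/-- **Positivity of the polar weight and of the archimedean layer of the window image** (crux
`OddBartaFloor`, line Sketch, stub `imagePositivity`): for `a > 0`, the polar weight
`ϖ_a = ∫_{s>a} (−Φ′(s))·2 sinh(s/2) ds ≥ 0` (`Φ′ < 0` on `(0, ∞)`) and the archimedean layer
`A_a(t) = ∫ R_a(s) w(|t − s|) ds ≥ 0` for all `t ∈ (0, a)` (symmetrise `s ↦ −s`: the integrand
becomes `R_a(s)(w(|t − s|) − w(|t + s|)) ≥ 0`, `w` antitone on `(0, ∞)`). -/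
theorem stub_imagePositivity :
    ∀ a : ℝ, 0 < a → 0 ≤ oddThetaPolarWeight a ∧ (∀ t ∈ Ioo 0 a, 0 ≤ oddThetaArchLayer a t) :=
  fun _ ha => ⟨stub_imagePositivity_polarWeight_nonneg ha,
    fun _ ht => stub_imagePositivity_archLayer_nonneg ht⟩

end Summit.RiemannHypothesis.RiemannHypothesis.Theorems.OddBartaFloor

end
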